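import Summits.QuantumFields.YangMills.Theorems.BalabanUVNodesN07ChartDDecayAnalytic
import Literature.MathematicalPhysics.QuantumFieldTheory.Balaban1983to89.B11SchwarzRemainder
import HarnessLib

/-!
# BalabanUVNodes ∕ N07 — [15] p. 289, THE REMARK AFTER PROPOSITION 3 AT NODE 00's RECORD: «The operator 𝔇(A′) is an analytic function in A′, and its expansion begins with
# a linear term in A′ … If we subtract these terms from 𝔇(A′), then we get an operator 𝔇₂(A′) for which we have the bound (73) with ε₃² instead of ε₃» — for the TRUE
# multi-level chart `D(·)` of (47)–(49), in (73)'s kernel shape with the exponential decay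

Cell `pub-ymgap`, width seat `pub-ymgap-dag-n07-w2` generation 5 (HUMAN RULING D-0149; DAG node N07 = [15] = [Balaban1985Variational]; W-SEAT START LIST §n07 item 2 = S2
«[15] Sect. C (47)–(49), Prop. 3 at objects» — the last printed sentence of Sect. C).  `--kind proof --supports stmt-QuantumFields-27364 --as helper` (K1⁹ face per KEY MAP v2;
count-neutral).  CONSUMED BY NAME, nothing modified: lit-balaban r08's `B11SchwarzRemainder.{OrderGe, leadCoeff, leadCoeff_one, orderGe_iff_isBigO, norm_sub_leadCoeff_le_two}`
(the one-variable order-`n` Schwarz lemma with the next remainder — cell GAPS G-adv9-52's instrument; its `reading_frakD2` ∕ `tightness_witness` are the abstract reading of this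
remark); this seat's `N07ChartDDecayAnalytic.exists_chartD_kernelEntry_decay_T4_analytic` (ONE `(H, Dfun)` at the record with (73)'s kernel-entry decay at every point of the
weighted ball AND `fderiv ℂ Dfun` holomorphic there); dag k0-s1-w2's `K0Stub1ChartDAnalytic.isOpen_weightedBall`.

THE PRINT (p. 289 [PDF 13], render `…/1985-cmp102-variational-background-p013-x2.png` re-read by this seat): (73) «|𝔇(A′; c, b)| ≦ O(1)C₃ε₃(Lʲη)^{−d+1}e^{−(1/2)δ₀d(c₋,y)}, b ∈ Bʲ(y),
y ∈ Λ_j»; Proposition 3 («… defined and analytic for A′ satisfying (43) with ε₃ sufficiently small (e.g. 18C₂B₀dc₁(½)ε₃ ≦ 1, 2ε₃ ≦ c₄) … its functional derivative satisfies the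
bound (73)»); then: «In the next section we will need the following remark. The operator 𝔇(A′) is an analytic function in A′, and its expansion begins with a linear term in A′,
coming from the differentiation of D^{(2)}(A′) = C^{(2)}(A′). If we subtract these terms from 𝔇(A′), then we get an operator 𝔇₂(A′) for which we have the bound (73) with ε₃²
instead of ε₃.»  Consumer in print: Sect. D (85)–(86) p. 291, `−⟨H δD₃(A′)∕δA′, J⟩ = −Σ … tr J(b′)H(b′, c₁)𝔇₂(A′; c₁, b)`.

THE READING (cell GAPS G-adv9-52; r08's `reading_frakD2` ∕ `tightness_witness`).  (73) is LINEAR in the chart radius; along a complex slice `τ ↦ 𝔇(τA′; c, b)` the Cauchy ∕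
Schwarz estimate turns «bounded by `M` on the disc `|τ| < r`, vanishing at `τ = 0`» into «remainder after the linear term `≤ 2M(|τ|∕r)²`» — so `ε₃²` is obtained when the
package is run at the WINDOW radius `ε` (fixed by the record's constants, `k`-uniform) and the point `A′` has weighted size `σ = ε₃ < ε`: the constant is `O(1)·2∕ε`, the radius in
the constant, NOT a radius-free `O(1)` (lit-balaban p06's `B11Rem289KernelConcrete` obtains a radius-free `(d, L)`-constant on the concrete one-scale carrier by a different,
three-term route; the multi-scale record version is this file's, by print's own suggested argument).  The subtracted «linear term» is, by definition, the derivative at `0` of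
`A′ ↦ 𝔇(A′)`, i.e. `(fderiv ℂ (fderiv ℂ Dfun) 0) A′ = D²D(0)(A′, ·)` — the differential of the second-order part `D^{(2)}(A′) = ½D²D(0)(A′, A′)`; its identification with
`2C^{(2)}(A′, ·)` ((56): `D^{(2)} = C^{(2)}`) is NOT re-derived here and not needed for the bound.  «begins with a linear term»: `fderiv ℂ Dfun 0 = 0` from (55) (§1).

WHAT IS PROVED (sorry-free; no definition; axioms standard).
§1 (abstract: `Φ : X → Y` between complex normed spaces, `π : Y →L[ℂ] E` a read-out, `E` complete) `hasFDerivAt_zero_of_sq_bound` (a quadratic bound near `0` forces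
   `DΦ(0) = 0`) · `differentiableOn_slice_fderiv` (the slice `τ ↦ π(DΦ(τ•A)v)` is holomorphic on the disc mapped into the holomorphy domain of `DΦ`) ·
   `hasDerivAt_slice_fderiv_zero` (its derivative at `0` is `π(D²Φ(0)(A)v)`) · `orderGe_one_of_hasDerivAt` · ★★★ `norm_slice_fderiv_sub_linearTerm_le` ∕
   `norm_fderiv_sub_linearTerm_le` (THE SCHWARZ STEP FOR THE DERIVATIVE's LINEAR TERM: `‖π(DΦ(τ•A)v)‖ ≤ M` on `|τ| < r`, `DΦ(0) = 0` ⇒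
   `‖π(DΦ(τ•A)v) − τ•π(D²Φ(0)(A)v)‖ ≤ 2M(|τ|∕r)²`; at `τ = 1 < r`: `‖π((DΦ(A) − D²Φ(0)A)v)‖ ≤ 2M∕r²`) · ★★ `norm_linearTerm_le` (the linear term itself:
   `‖π(D²Φ(0)(A)v)‖ ≤ M∕r`, Cauchy's coefficient bound).
§2 `fderiv_zero_of_weighted_sq_bound` ((55) in the weighted currency ⇒ `fderiv ℂ Dfun 0 = 0`) · ★★★★ `exists_chartD2_T4` — for every `F : T4Family`: thresholds and constants as in
   `exists_chartD_kernelEntry_decay_T4_analytic`; for every record datum and `ε` in the window: `H` (right inverse + (46) letter), `Dfun` (`C^ω`, `fderiv` holomorphic,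
   **`fderiv ℂ Dfun 0 = 0`**, and at every point of the ball (55), (49), (48), `HasFDerivAt Dfun (fderiv ℂ Dfun A′) A′`, the norm-level (73) and the kernel-entry decay of
   `fderiv ℂ Dfun A′`), the LINEAR TERM `𝔇^{(1)}(A′) := (fderiv ℂ (fderiv ℂ Dfun) 0) A′` with `‖(𝔇^{(1)}(A′)W)(j,c)‖ ≤ 4C₃σ·t` and the kernel-entry decay
   `4C₃σ·e^{2δ}·w₁(b)‖a‖·e^{−δ·distBI}` for `A′` of weighted size `≤ σ` (any `σ > 0`), AND, writing `𝔇₂(A′) := fderiv ℂ Dfun A′ − 𝔇^{(1)}(A′)`, for every `0 < σ < ε` and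
   every `A′` of weighted size `≤ σ`:
   (norm level) **`‖(𝔇₂(A′)W)(j,c)‖ ≤ 8C₃·(σ²∕ε)·t`** whenever `w₁(b)‖W b‖ ≤ t`; (kernel entries, rate `0 ≤ δ ≤ ½δ₀` in the `δ`-window)
   **`‖(𝔇₂(A′)(δ_b·a))(j,c)‖ ≤ 8C₃e^{2δ}·(σ²∕ε)·w₁(b)‖a‖·e^{−δ·distBI D b (j,c)}`** — «the bound (73) with ε₃² instead of ε₃», `O(1) = 8e^{2δ}∕ε`.

HONEST FRAMING: count-neutral helper; one-variable Cauchy∕Schwarz bookkeeping (r08's kernel-checked tool) on this seat's record package — NO new estimate of [15]; the `ε²`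
carries the window radius in its constant (located reading G-adv9-52, print's own suggested argument), not p06's radius-free route; `D^{(2)} = C^{(2)}` ((56)), (58), the ∇-row,
(85)–(86) and [15] Sects. D–F NOT here; stub 1 ∕ K0⁷ ∕ K1⁹ NOT closed; N07 NOT discharged; counts unmoved; one finite T⁴ programme at fixed ε — NOT continuum ∕ ℝ⁴ ∕ OS ∕
mass gap ∕ Clay: the Yang–Mills mass gap is NOT proved by any of this; R4 closes the conditional rung `BalabanLadder.UV` only.  No `sorry`, no `def`, no `instance`, no `notation`.

References: [15] T. Bałaban, CMP 102 (1985) 277–309 [Balaban1985Variational] ((55)–(56) p.286, (63) p.287, (73) + Prop. 3 + remark p.289, (78)∕(80) p.290, (85)–(86) p.291);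
[4] = [B7] CMP 98 (1985) 17–51 [Balaban1985Averaging] ((134)–(137) pp.38–39).
-/

noncomputable section

open scoped BigOperators Matrix.Norms.L2Operator ContDiff Topology
open NormedSpace Metric Set Filter Asymptotics

namespace Summit.QuantumFields.YangMills.BalabanUVNodes.N07ChartD2Remainder

open Literature.MathematicalPhysics.QuantumFieldTheory.Balaban1983to89
open Literature.MathematicalPhysics.QuantumFieldTheory.Balaban1983to89.T4Continuum (T4Family)
open Literature.MathematicalPhysics.QuantumFieldTheory.Balaban1983to89.B11SchwarzRemainder (OrderGe leadCoeff leadCoeff_one orderGe_iff_isBigO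
  norm_sub_leadCoeff_le_two norm_leadCoeff_le)
open B6SectADomainsV1 (Domains)
open B6SectAOperatorsV1 (BondIdx)
open Summit.QuantumFields.YangMills.Theorems.FlatCubeOpsText (Adm22 distBI)
open Summit.QuantumFields.YangMills.Theorems.K0FlatCubeOpsTextP (IsLevWeight levWeight_nonneg)
open Summit.QuantumFields.YangMills.Theorems.Prop8Chart (chartLog)
open Summit.QuantumFields.YangMills.Theorems.K0Stub1ChartDAnalytic (isOpen_weightedBall)
open Summit.QuantumFields.YangMills.BalabanUVNodes.N07ChartDDecayAnalytic (exists_chartD_kernelEntry_decay_T4_analytic)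

/-! ## §1 The Schwarz step for the linear term of a derivative (abstract) -/

section Abstract

variable {X Y E : Type*} [NormedAddCommGroup X] [NormedSpace ℂ X] [NormedAddCommGroup Y] [NormedSpace ℂ Y]
  [NormedAddCommGroup E] [NormedSpace ℂ E]

/-- **«ITS EXPANSION BEGINS WITH A LINEAR TERM»**: a map with a quadratic bound `‖Φ x‖ ≤ C‖x‖²` near `0` has `Φ 0 = 0` and Fréchet derivative `0` at `0` (how (55) «a power
series expansion of D(A′) begins with second order terms» makes the derivative `𝔇 = δD∕δA′` vanish at `A′ = 0`). [cite: Balaban1985Variational, (55) p.286, remark p.289] -/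
theorem hasFDerivAt_zero_of_sq_bound {Φ : X → Y} {C r : ℝ} (hr : 0 < r) (h : ∀ x : X, ‖x‖ < r → ‖Φ x‖ ≤ C * ‖x‖ ^ 2) :
    HasFDerivAt Φ (0 : X →L[ℂ] Y) 0 := by
  have h0 : Φ 0 = 0 := by
    have h00 := h 0 (by simpa using hr)
    rw [norm_zero, zero_pow two_ne_zero, mul_zero] at h00
    exact norm_le_zero_iff.mp h00
  rw [hasFDerivAt_iff_isLittleO_nhds_zero]
  have hfun : (fun h : X => Φ (0 + h) - Φ 0 - (0 : X →L[ℂ] Y) h) = Φ := by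
    funext h; simp [h0]
  rw [hfun]
  have h1 : Φ =O[𝓝 (0 : X)] (fun x : X => ‖x‖ ^ 2) := by
    refine IsBigO.of_bound C ?_
    filter_upwards [Metric.ball_mem_nhds (0 : X) hr] with x hx
    rw [Real.norm_of_nonneg (by positivity)]
    exact h x (mem_ball_zero_iff.mp hx)
  exact h1.trans_isLittleO (isLittleO_norm_pow_id one_lt_two)

/-- The slice of the derivative along a complex line, read out by `π` at the direction `v`: `τ ↦ π(DΦ(τ•A)v)` is holomorphic on every disc `|τ| < r` whose line segment lies in a
set `U` on which `DΦ` is holomorphic (the slice device of [4] (137) applied to `𝔇(A′) = δD(A′)∕δA′`, (63)). [cite: Balaban1985Variational, (63) p.287, remark p.289; Balaban1985Averaging, (137) p.39] -/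
theorem differentiableOn_slice_fderiv {Φ : X → Y} {U : Set X} (hd : DifferentiableOn ℂ (fderiv ℂ Φ) U) (A v : X) (π : Y →L[ℂ] E) {r : ℝ}
    (hmaps : ∀ τ : ℂ, ‖τ‖ < r → τ • A ∈ U) :
    DifferentiableOn ℂ (fun τ : ℂ => π (fderiv ℂ Φ (τ • A) v)) (ball (0 : ℂ) r) := by
  have h1 : DifferentiableOn ℂ (fun τ : ℂ => fderiv ℂ Φ (τ • A)) (ball (0 : ℂ) r) := by
    refine hd.comp (f := fun τ : ℂ => τ • A) (differentiableOn_id.smul_const A) ?_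
    intro τ hτ
    exact hmaps τ (mem_ball_zero_iff.mp hτ)
  have h2 : DifferentiableOn ℂ (fun τ : ℂ => (fderiv ℂ Φ (τ • A)) v) (ball (0 : ℂ) r) :=
    (ContinuousLinearMap.apply ℂ Y v).differentiable.comp_differentiableOn h1
  exact π.differentiable.comp_differentiableOn h2

/-- The derivative of the slice at `τ = 0` is the «linear term» `π(D²Φ(0)(A)v)` (chain rule; `DΦ` differentiable at `0 ∈ U`, `U` open).
[cite: Balaban1985Variational, remark p.289] -/
theorem hasDerivAt_slice_fderiv_zero {Φ : X → Y} {U : Set X} (hU : IsOpen U) (h0U : (0 : X) ∈ U) (hd : DifferentiableOn ℂ (fderiv ℂ Φ) U)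
    (A v : X) (π : Y →L[ℂ] E) :
    HasDerivAt (fun τ : ℂ => π (fderiv ℂ Φ (τ • A) v)) (π ((fderiv ℂ (fderiv ℂ Φ) 0 A) v)) 0 := by
  have hdiff : DifferentiableAt ℂ (fderiv ℂ Φ) 0 := hd.differentiableAt (hU.mem_nhds h0U)
  have hline : HasDerivAt (fun τ : ℂ => τ • A) A 0 := by
    simpa using (hasDerivAt_id (0 : ℂ)).smul_const A
  have h1 : HasDerivAt (fun τ : ℂ => fderiv ℂ Φ (τ • A)) ((fderiv ℂ (fderiv ℂ Φ) 0) A) 0 :=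
    HasFDerivAt.comp_hasDerivAt_of_eq (0 : ℂ) hdiff.hasFDerivAt hline (by simp)
  exact (π.comp (ContinuousLinearMap.apply ℂ Y v)).hasFDerivAt.comp_hasDerivAt (0 : ℂ) h1

/-- A function `f : ℂ → E` differentiable at `0` with `f 0 = 0` «begins with terms of order `1`» in r08's sense (`OrderGe f 1`). [folklore] -/
theorem orderGe_one_of_hasDerivAt {f : ℂ → E} {f' : E} (hf : HasDerivAt f f' 0) (h0 : f 0 = 0) : OrderGe f 1 := by
  rw [orderGe_iff_isBigO]
  have h := hf.hasFDerivAt.isBigO_sub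
  simp only [h0, sub_zero] at h
  exact (h.mono nhdsWithin_le_nhds).congr_right (fun t => (pow_one t).symm)

variable [CompleteSpace E]

/-- ★★★ **THE SCHWARZ STEP FOR THE LINEAR TERM OF A DERIVATIVE (the p. 289 remark, abstract form).**  Let `DΦ = fderiv ℂ Φ` be holomorphic on an open `U`, `DΦ(0) = 0`, and let the
complex line `τ ↦ τ•A` (`|τ| < r`) lie in `U`.  If the read-out `π(DΦ(τ•A)v)` is bounded by `M` on the disc, then after subtracting the linear term `τ•π(D²Φ(0)(A)v)` the remainder
is `≤ 2M(|τ|∕r)²` on the disc — r08's `norm_sub_leadCoeff_le_two` at `n = 1` on the slice, with `leadCoeff = f′(0)` identified by the chain rule.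
[cite: Balaban1985Variational, (73) + remark p.289] -/
theorem norm_slice_fderiv_sub_linearTerm_le {Φ : X → Y} {U : Set X} (hU : IsOpen U) (hd : DifferentiableOn ℂ (fderiv ℂ Φ) U) (hΦ0 : fderiv ℂ Φ 0 = 0)
    (A v : X) (π : Y →L[ℂ] E) {r M : ℝ} (hmaps : ∀ τ : ℂ, ‖τ‖ < r → τ • A ∈ U)
    (hM : ∀ τ : ℂ, ‖τ‖ < r → ‖π (fderiv ℂ Φ (τ • A) v)‖ ≤ M) {τ : ℂ} (hτ : ‖τ‖ < r) :
    ‖π (fderiv ℂ Φ (τ • A) v) - τ • π ((fderiv ℂ (fderiv ℂ Φ) 0 A) v)‖ ≤ 2 * M * (‖τ‖ / r) ^ 2 := by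
  have hr : 0 < r := (norm_nonneg τ).trans_lt hτ
  have h0U : (0 : X) ∈ U := by simpa using hmaps 0 (by simpa using hr)
  set f : ℂ → E := fun s => π (fderiv ℂ Φ (s • A) v) with hf
  have hfd : DifferentiableOn ℂ f (ball (0 : ℂ) r) := differentiableOn_slice_fderiv hd A v π hmaps
  have hfM : ∀ t ∈ ball (0 : ℂ) r, ‖f t‖ ≤ M := fun t ht => hM t (mem_ball_zero_iff.mp ht)
  have hder : HasDerivAt f (π ((fderiv ℂ (fderiv ℂ Φ) 0 A) v)) 0 := hasDerivAt_slice_fderiv_zero hU h0U hd A v π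
  have hf0 : f 0 = 0 := by simp [hf, hΦ0]
  have hO : OrderGe f 1 := orderGe_one_of_hasDerivAt hder hf0
  have hlc : leadCoeff f 1 = π ((fderiv ℂ (fderiv ℂ Φ) 0 A) v) := by rw [leadCoeff_one, hder.deriv]
  have h := norm_sub_leadCoeff_le_two hfd hfM hO (mem_ball_zero_iff.mpr hτ)
  rw [hlc, pow_one] at h
  exact h

/-- ★★★ The same at the point itself (`τ = 1 < r`): **`‖π((DΦ(A) − D²Φ(0)A)v)‖ ≤ 2M∕r²`** — the larger the disc on which the bound `M` is available, the smaller the remainder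
(«Schwarz: c·r·(z∕r)² = c·z²∕r», cell GAPS G-adv9-52). [cite: Balaban1985Variational, (73) + remark p.289] -/
theorem norm_fderiv_sub_linearTerm_le {Φ : X → Y} {U : Set X} (hU : IsOpen U) (hd : DifferentiableOn ℂ (fderiv ℂ Φ) U) (hΦ0 : fderiv ℂ Φ 0 = 0)
    (A v : X) (π : Y →L[ℂ] E) {r M : ℝ} (hr : 1 < r) (hmaps : ∀ τ : ℂ, ‖τ‖ < r → τ • A ∈ U)
    (hM : ∀ τ : ℂ, ‖τ‖ < r → ‖π (fderiv ℂ Φ (τ • A) v)‖ ≤ M) :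
    ‖π (fderiv ℂ Φ A v) - π ((fderiv ℂ (fderiv ℂ Φ) 0 A) v)‖ ≤ 2 * M / r ^ 2 := by
  have h := norm_slice_fderiv_sub_linearTerm_le hU hd hΦ0 A v π hmaps hM (τ := 1) (by simpa using hr)
  rw [one_smul, one_smul, norm_one, div_pow, one_pow, ← mul_div_assoc, mul_one] at h
  exact h

/-- ★★ **THE LINEAR TERM ITSELF** (Cauchy's coefficient bound, r08's `norm_leadCoeff_le` at `n = 1` on the slice): under the same data with `r > 0`,
**`‖π(D²Φ(0)(A)v)‖ ≤ M∕r`** — the subtracted linear term `𝔇^{(1)}(A)` obeys the bound of `𝔇` with the ratio «size of `A` ∕ radius» in place of the radius.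
[cite: Balaban1985Variational, (73) + remark p.289] -/
theorem norm_linearTerm_le {Φ : X → Y} {U : Set X} (hU : IsOpen U) (hd : DifferentiableOn ℂ (fderiv ℂ Φ) U) (hΦ0 : fderiv ℂ Φ 0 = 0)
    (A v : X) (π : Y →L[ℂ] E) {r M : ℝ} (hr : 0 < r) (hmaps : ∀ τ : ℂ, ‖τ‖ < r → τ • A ∈ U)
    (hM : ∀ τ : ℂ, ‖τ‖ < r → ‖π (fderiv ℂ Φ (τ • A) v)‖ ≤ M) :
    ‖π ((fderiv ℂ (fderiv ℂ Φ) 0 A) v)‖ ≤ M / r := by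
  have h0U : (0 : X) ∈ U := by simpa using hmaps 0 (by simpa using hr)
  set f : ℂ → E := fun s => π (fderiv ℂ Φ (s • A) v) with hf
  have hfd : DifferentiableOn ℂ f (ball (0 : ℂ) r) := differentiableOn_slice_fderiv hd A v π hmaps
  have hfM : ∀ t ∈ ball (0 : ℂ) r, ‖f t‖ ≤ M := fun t ht => hM t (mem_ball_zero_iff.mp ht)
  have hder : HasDerivAt f (π ((fderiv ℂ (fderiv ℂ Φ) 0 A) v)) 0 := hasDerivAt_slice_fderiv_zero hU h0U hd A v π
  have hf0 : f 0 = 0 := by simp [hf, hΦ0]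
  have hO : OrderGe f 1 := orderGe_one_of_hasDerivAt hder hf0
  have hlc : leadCoeff f 1 = π ((fderiv ℂ (fderiv ℂ Φ) 0 A) v) := by rw [leadCoeff_one, hder.deriv]
  have h := norm_leadCoeff_le hr hfd hfM hO
  rw [hlc, pow_one] at h
  exact h

end Abstract

/-! ## §2 The remark at NODE 00's record -/

/-- **(55) IN THE WEIGHTED CURRENCY ⇒ `𝔇(0) = 0`**: if `‖Φ x i‖ ≤ C·ρ²` for every weighted size bound `ρ` of `x` (weights `wt ≥ 0`) at every `x` of the weighted `ε`-ball, then
`fderiv ℂ Φ 0 = 0` (finitely many coordinates: weighted size `≤ (Σ wt)·‖x‖`). [cite: Balaban1985Variational, (55) p.286, remark p.289] -/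
theorem fderiv_zero_of_weighted_sq_bound {α β : Type*} [Fintype α] [Fintype β] {V : Type*} [NormedAddCommGroup V] [NormedSpace ℂ V]
    (wt : α → ℝ) (hwt : ∀ a, 0 ≤ wt a) {ε C : ℝ} (hε : 0 < ε) (hC : 0 ≤ C) (Φ : (α → V) → (β → V))
    (h55 : ∀ x : α → V, (∀ a, wt a * ‖x a‖ < ε) → ∀ ρ : ℝ, 0 ≤ ρ → (∀ a, wt a * ‖x a‖ ≤ ρ) → ∀ i, ‖Φ x i‖ ≤ C * ρ ^ 2) :
    fderiv ℂ Φ 0 = 0 := by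
  set S : ℝ := ∑ a, wt a with hS
  have hS0 : 0 ≤ S := Finset.sum_nonneg fun a _ => hwt a
  have hle : ∀ (x : α → V) (a : α), wt a * ‖x a‖ ≤ S * ‖x‖ := fun x a =>
    mul_le_mul (Finset.single_le_sum (fun a _ => hwt a) (Finset.mem_univ a)) (norm_le_pi_norm x a) (norm_nonneg _) hS0
  have hr : 0 < ε / (S + 1) := div_pos hε (by linarith)
  refine (hasFDerivAt_zero_of_sq_bound (C := C * S ^ 2) hr fun x hx => ?_).fderiv
  have hball : ∀ a, wt a * ‖x a‖ < ε := fun a => by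
    refine (hle x a).trans_lt ?_
    have h1 : S * ‖x‖ ≤ (S + 1) * ‖x‖ := by nlinarith [norm_nonneg x]
    have h2 : (S + 1) * ‖x‖ < (S + 1) * (ε / (S + 1)) := mul_lt_mul_of_pos_left hx (by linarith)
    rw [mul_div_cancel₀ _ (by linarith : S + 1 ≠ 0)] at h2
    linarith
  have hcoord := h55 x hball (S * ‖x‖) (by positivity) (hle x)
  refine (pi_norm_le_iff_of_nonneg (by positivity)).mpr fun i => (hcoord i).trans (le_of_eq (by ring))

/-- ★★★★ **[15] p. 289, THE REMARK AFTER PROPOSITION 3, AT NODE 00's RECORD — «𝔇₂(A′) obeys (73) with ε₃² instead of ε₃», kernel shape with exponential decay.**  For every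
`F : T4Family` there are thresholds `M_h⁰, R₀` and constants `C_K ≥ 0`, `δ₀ > 0`, `B₃ > 0` such that for every admissible nested family `D` of top level `K − n` on NODE 00's torus
(`Adm22 D R (L·M_h)`, `R ≥ R₀`, `2L ≤ R`, size side conditions), every level-weight family `w`, every `ε > 0` in the window (`18C₂B₀′ε ≤ 1`, `64ε ≤ R⋆`): there are the route's right
inverse `H` of `D chartLog(0)` with its (46) letter and the chart map `Dfun` of (47)–(49) — `C^ω` with `fderiv ℂ Dfun` holomorphic on the weighted `ε`-ball, **`fderiv ℂ Dfun 0 = 0`**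
(«begins with a linear term»), and at every point of the ball (55), (49), (48), `HasFDerivAt Dfun (fderiv ℂ Dfun A′) A′`, the norm-level (73) `‖𝔇W (j,c)‖ ≤ 4C₃ε·t` and the
kernel-entry decay `‖𝔇(δ_b·a)(j,c)‖ ≤ 4C₃ε·e^{2δ}·w₁(b)‖a‖·e^{−δ·distBI D b (j,c)}` (`𝔇 = fderiv ℂ Dfun A′`) — AND, with `𝔇₂(A′) := fderiv ℂ Dfun A′ − (fderiv ℂ (fderiv ℂ Dfun) 0) A′`
(the derivative minus its linear term `𝔇^{(1)}(A′) = D²D(0)(A′, ·)`, which itself obeys `‖(𝔇^{(1)}(A′)W)(j,c)‖ ≤ 4C₃σ·t` and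
`‖(𝔇^{(1)}(A′)(δ_b·a))(j,c)‖ ≤ 4C₃σ·e^{2δ}·w₁(b)‖a‖·e^{−δ·distBI D b (j,c)}` for `A′` of weighted size `≤ σ`, any `σ > 0` — Cauchy's coefficient bound), for every `0 < σ < ε`
and every `A′` of weighted size `≤ σ`: (norm level) **`‖(𝔇₂(A′)W)(j,c)‖ ≤ 8C₃(σ²∕ε)·t`** whenever
`w₁(b)‖W b‖ ≤ t`; (kernel entries, every fine bond `b`, matrix `a`, rate `0 ≤ δ ≤ ½δ₀` in the `δ`-window, index `(j,c)`)
**`‖(𝔇₂(A′)(δ_b·a))(j,c)‖ ≤ 8C₃·e^{2δ}·(σ²∕ε)·w₁(b)‖a‖·e^{−δ·distBI D b (j,c)}`** — (73) with `σ² = ε₃²` in place of `ε₃`, `O(1) = 8e^{2δ}∕ε` (the window radius in the constant, cell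
GAPS G-adv9-52).  Proof: §1 on the slices `τ ↦ ((fderiv ℂ Dfun (τ•A′)) W)(j,c)`, `|τ| < ε∕σ`, of `N07ChartDDecayAnalytic.exists_chartD_kernelEntry_decay_T4_analytic`'s package.
[cite: Balaban1985Variational, (55) p.286, (63) p.287, (73) + Prop. 3 + remark p.289, (85)-(86) p.291; Balaban1985Averaging, (137) p.39] -/
theorem exists_chartD2_T4 {ι : Type*} [Fintype ι] [DecidableEq ι] [Nonempty ι] (F : T4Family) :
    ∃ (Mh₀ R₀ : ℕ) (CK δ₀ B₃ : ℝ), 0 ≤ CK ∧ 0 < δ₀ ∧ 0 < B₃ ∧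
    ∀ (n K : ℕ) (_ : 1 ≤ K - n) (_ : K - n + 1 ≤ F.m + K) {Mh R a' : ℕ} (_ : Mh = F.L ^ a') (_ : Mh₀ ≤ Mh) (_ : R₀ ≤ R) (_ : 2 * F.L ≤ R)
      (_ : a' + 3 ≤ F.m + n) (D : Domains (F.P K)) (_ : D.k = K - n) (_ : Adm22 D R (F.L * Mh))
      (w : ℕ → PBond (F.P K) 0 → ℝ) (_ : IsLevWeight (F.P K) (K - n) D w) {ε : ℝ} (_ : 0 < ε)
      (_ : 18 * (960 * ((((F.P K).d + 2) * (F.P K).L : ℕ) : ℝ) * ((F.P K).L : ℝ) / (12800 * ((((F.P K).d + 2) * (F.P K).L : ℕ) : ℝ) ^ 2 * ((F.P K).L : ℝ))⁻¹) *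
        (CK * B₃ * (1 + 2 * (((F.P K).d + 2) * (F.P K).L : ℕ)) * (1 + 2 * (((F.P K).d + 2) * (F.P K).L : ℕ) * (1 + (F.P K).L))) * ε ≤ 1)
      (_ : 64 * ε ≤ (12800 * ((((F.P K).d + 2) * (F.P K).L : ℕ) : ℝ) ^ 2 * ((F.P K).L : ℝ))⁻¹),
      let η : ℝ := (((F.P K).L : ℝ)⁻¹) ^ (K - n)
      let Rs : ℝ := (12800 * ((((F.P K).d + 2) * (F.P K).L : ℕ) : ℝ) ^ 2 * ((F.P K).L : ℝ))⁻¹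
      let C₂ : ℝ := 960 * ((((F.P K).d + 2) * (F.P K).L : ℕ) : ℝ) * ((F.P K).L : ℝ) / Rs
      let C₃ : ℝ := 3840 * ((((F.P K).d + 2) * (F.P K).L : ℕ) : ℝ) * ((F.P K).L : ℝ) / Rs
      let Qlin := (fderiv ℂ (chartLog η D : (PBond (F.P K) 0 → Matrix ι ι ℂ) → BondIdx D → Matrix ι ι ℂ) 0)
      ∃ (H : (BondIdx D → Matrix ι ι ℂ) →ₗ[ℂ] (PBond (F.P K) 0 → Matrix ι ι ℂ)) (Dfun : (PBond (F.P K) 0 → Matrix ι ι ℂ) → (BondIdx D → Matrix ι ι ℂ)),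
        (∀ X, Qlin (H X) = X) ∧
        (∀ (X : BondIdx D → Matrix ι ι ℂ) (t : ℝ), 0 ≤ t → (∀ i, ‖X i‖ ≤ t) → ∀ b,
          w 1 b * ‖H X b‖ ≤ CK * B₃ * (1 + 2 * (((F.P K).d + 2) * (F.P K).L : ℕ)) * (1 + 2 * (((F.P K).d + 2) * (F.P K).L : ℕ) * (1 + (F.P K).L)) * t) ∧
        ContDiffOn ℂ ω Dfun {A' : PBond (F.P K) 0 → Matrix ι ι ℂ | ∀ b, w 1 b * ‖A' b‖ < ε} ∧
        DifferentiableOn ℂ (fderiv ℂ Dfun) {A' : PBond (F.P K) 0 → Matrix ι ι ℂ | ∀ b, w 1 b * ‖A' b‖ < ε} ∧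
        fderiv ℂ Dfun 0 = 0 ∧
        (∀ A' : PBond (F.P K) 0 → Matrix ι ι ℂ, (∀ b, w 1 b * ‖A' b‖ < ε) →
          (∀ (ρ : ℝ), 0 ≤ ρ → (∀ b, w 1 b * ‖A' b‖ ≤ ρ) → ∀ i, ‖Dfun A' i‖ ≤ 4 * C₂ * ρ ^ 2) ∧
          chartLog η D (A' - H (Dfun A')) - Qlin (A' - H (Dfun A')) = Dfun A' ∧
          chartLog η D (A' - H (Dfun A')) = Qlin A' ∧
          HasFDerivAt Dfun (fderiv ℂ Dfun A') A' ∧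
          (∀ (W : PBond (F.P K) 0 → Matrix ι ι ℂ) (t : ℝ), 0 ≤ t → (∀ b, w 1 b * ‖W b‖ ≤ t) → ∀ i, ‖fderiv ℂ Dfun A' W i‖ ≤ 4 * C₃ * ε * t) ∧
          ∀ (b : PBond (F.P K) 0) (a : Matrix ι ι ℂ) (δ : ℝ), 0 ≤ δ → δ ≤ δ₀ / 2 →
            4 * C₃ * Real.exp (δ * 3) *
                (CK * B₃ * (1 + 2 * (((F.P K).d + 2) * (F.P K).L : ℕ) * Real.exp (δ * 4)) *
                  (1 + 2 * (((F.P K).d + 2) * (F.P K).L : ℕ) * (1 + (F.P K).L) * Real.exp (δ * 1))) * ε ≤ 1 →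
            ∀ i, ‖fderiv ℂ Dfun A' (Pi.single b a) i‖ ≤ 4 * C₃ * ε * Real.exp (δ * 2) * (w 1 b * ‖a‖) * Real.exp (-(δ * distBI D b i))) ∧
        (∀ σ : ℝ, 0 < σ → ∀ A' : PBond (F.P K) 0 → Matrix ι ι ℂ, (∀ b, w 1 b * ‖A' b‖ ≤ σ) →
          ∀ (W : PBond (F.P K) 0 → Matrix ι ι ℂ) (t : ℝ), 0 ≤ t → (∀ b, w 1 b * ‖W b‖ ≤ t) → ∀ i,
            ‖(fderiv ℂ (fderiv ℂ Dfun) 0 A') W i‖ ≤ 4 * C₃ * σ * t) ∧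
        (∀ σ : ℝ, 0 < σ → ∀ A' : PBond (F.P K) 0 → Matrix ι ι ℂ, (∀ b, w 1 b * ‖A' b‖ ≤ σ) →
          ∀ (b : PBond (F.P K) 0) (a : Matrix ι ι ℂ) (δ : ℝ), 0 ≤ δ → δ ≤ δ₀ / 2 →
            4 * C₃ * Real.exp (δ * 3) *
                (CK * B₃ * (1 + 2 * (((F.P K).d + 2) * (F.P K).L : ℕ) * Real.exp (δ * 4)) *
                  (1 + 2 * (((F.P K).d + 2) * (F.P K).L : ℕ) * (1 + (F.P K).L) * Real.exp (δ * 1))) * ε ≤ 1 →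
            ∀ i, ‖(fderiv ℂ (fderiv ℂ Dfun) 0 A') (Pi.single b a) i‖ ≤
              4 * C₃ * σ * Real.exp (δ * 2) * (w 1 b * ‖a‖) * Real.exp (-(δ * distBI D b i))) ∧
        (∀ σ : ℝ, 0 < σ → σ < ε → ∀ A' : PBond (F.P K) 0 → Matrix ι ι ℂ, (∀ b, w 1 b * ‖A' b‖ ≤ σ) →
          ∀ (W : PBond (F.P K) 0 → Matrix ι ι ℂ) (t : ℝ), 0 ≤ t → (∀ b, w 1 b * ‖W b‖ ≤ t) → ∀ i,
            ‖(fderiv ℂ Dfun A' - fderiv ℂ (fderiv ℂ Dfun) 0 A') W i‖ ≤ 8 * C₃ * (σ ^ 2 / ε) * t) ∧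
        (∀ σ : ℝ, 0 < σ → σ < ε → ∀ A' : PBond (F.P K) 0 → Matrix ι ι ℂ, (∀ b, w 1 b * ‖A' b‖ ≤ σ) →
          ∀ (b : PBond (F.P K) 0) (a : Matrix ι ι ℂ) (δ : ℝ), 0 ≤ δ → δ ≤ δ₀ / 2 →
            4 * C₃ * Real.exp (δ * 3) *
                (CK * B₃ * (1 + 2 * (((F.P K).d + 2) * (F.P K).L : ℕ) * Real.exp (δ * 4)) *
                  (1 + 2 * (((F.P K).d + 2) * (F.P K).L : ℕ) * (1 + (F.P K).L) * Real.exp (δ * 1))) * ε ≤ 1 →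
            ∀ i, ‖(fderiv ℂ Dfun A' - fderiv ℂ (fderiv ℂ Dfun) 0 A') (Pi.single b a) i‖ ≤
              8 * C₃ * Real.exp (δ * 2) * (σ ^ 2 / ε) * (w 1 b * ‖a‖) * Real.exp (-(δ * distBI D b i))) := by
  classical
  obtain ⟨Mh₀, R₀, CK, δ₀, B₃, hCK, hδ₀, hB₃, hmain⟩ := exists_chartD_kernelEntry_decay_T4_analytic (ι := ι) F
  refine ⟨Mh₀, R₀, CK, δ₀, B₃, hCK, hδ₀, hB₃, ?_⟩
  intro n K hk1 hk' Mh R a' hMha hMh hR h2L hsize D hDk hAdm w hw ε hε h18 h2 η Rs C₂ C₃ Qlin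
  obtain ⟨H, Dfun, hHinv, hsup, hdiff, hω, hfd, hDfun⟩ := hmain n K hk1 hk' hMha hMh hR h2L hsize D hDk hAdm w hw hε h18 h2
  have hwnn : ∀ b, 0 ≤ w 1 b := levWeight_nonneg hw 1
  have hC₂ : 0 ≤ C₂ := by
    show 0 ≤ 960 * ((((F.P K).d + 2) * (F.P K).L : ℕ) : ℝ) * ((F.P K).L : ℝ) / Rs; positivity
  -- the open weighted ball and `0` in it
  have hU : IsOpen {A' : PBond (F.P K) 0 → Matrix ι ι ℂ | ∀ b, w 1 b * ‖A' b‖ < ε} := isOpen_weightedBall w ε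
  -- at every point: the derivative IS `fderiv`, with its two (73) bounds
  have hpt : ∀ A' : PBond (F.P K) 0 → Matrix ι ι ℂ, (∀ b, w 1 b * ‖A' b‖ < ε) →
      HasFDerivAt Dfun (fderiv ℂ Dfun A') A' ∧
      (∀ (W : PBond (F.P K) 0 → Matrix ι ι ℂ) (t : ℝ), 0 ≤ t → (∀ b, w 1 b * ‖W b‖ ≤ t) → ∀ i, ‖fderiv ℂ Dfun A' W i‖ ≤ 4 * C₃ * ε * t) ∧
      ∀ (b : PBond (F.P K) 0) (a : Matrix ι ι ℂ) (δ : ℝ), 0 ≤ δ → δ ≤ δ₀ / 2 →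
        4 * C₃ * Real.exp (δ * 3) *
            (CK * B₃ * (1 + 2 * (((F.P K).d + 2) * (F.P K).L : ℕ) * Real.exp (δ * 4)) *
              (1 + 2 * (((F.P K).d + 2) * (F.P K).L : ℕ) * (1 + (F.P K).L) * Real.exp (δ * 1))) * ε ≤ 1 →
        ∀ i, ‖fderiv ℂ Dfun A' (Pi.single b a) i‖ ≤ 4 * C₃ * ε * Real.exp (δ * 2) * (w 1 b * ‖a‖) * Real.exp (-(δ * distBI D b i)) := by
    intro A' hA'
    obtain ⟨-, -, -, 𝔇, h𝔇, h73, hker⟩ := hDfun A' hA'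
    have heq : fderiv ℂ Dfun A' = 𝔇 := h𝔇.fderiv
    rw [heq]
    exact ⟨h𝔇, h73, hker⟩
  -- «begins with a linear term»: `fderiv ℂ Dfun 0 = 0` from (55)
  have h0 : fderiv ℂ Dfun 0 = 0 :=
    fderiv_zero_of_weighted_sq_bound (w 1) hwnn hε (by positivity : (0 : ℝ) ≤ 4 * C₂) Dfun (fun x hx => (hDfun x hx).1)
  -- the complex line through a point of weighted size `≤ σ` stays in the ball for `|τ| < ε∕σ`
  have hline : ∀ (σ : ℝ), 0 < σ → ∀ A' : PBond (F.P K) 0 → Matrix ι ι ℂ, (∀ b, w 1 b * ‖A' b‖ ≤ σ) →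
      ∀ τ : ℂ, ‖τ‖ < ε / σ → (τ • A') ∈ {A' : PBond (F.P K) 0 → Matrix ι ι ℂ | ∀ b, w 1 b * ‖A' b‖ < ε} := by
    intro σ hσ A' hA' τ hτ b
    show w 1 b * ‖(τ • A') b‖ < ε
    rw [Pi.smul_apply, norm_smul, mul_left_comm]
    have h1 : ‖τ‖ * (w 1 b * ‖A' b‖) ≤ ‖τ‖ * σ := mul_le_mul_of_nonneg_left (hA' b) (norm_nonneg τ)
    have h2 : ‖τ‖ * σ < ε := by rwa [lt_div_iff₀ hσ] at hτ
    linarith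
  refine ⟨H, Dfun, hHinv, hsup, hω, hfd, h0, fun A' hA' => ?_, ?_, ?_, ?_, ?_⟩
  · obtain ⟨h55, h49, h48, -⟩ := hDfun A' hA'
    exact ⟨h55, h49, h48, hpt A' hA'⟩
  · -- the linear term, norm level: Cauchy's coefficient bound `M∕r`, `M = 4C₃ε·t`, `r = ε∕σ`
    intro σ hσ A' hA' W t ht hW i
    have hr : 0 < ε / σ := div_pos hε hσ
    have h := norm_linearTerm_le hU hfd h0 A' W (ContinuousLinearMap.proj (R := ℂ) i) hr (hline σ hσ A' hA')
      (M := 4 * C₃ * ε * t) (fun τ hτ => (hpt (τ • A') (hline σ hσ A' hA' τ hτ)).2.1 W t ht hW i)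
    have h' : ‖(fderiv ℂ (fderiv ℂ Dfun) 0 A') W i‖ ≤ 4 * C₃ * ε * t / (ε / σ) := h
    have hεne : ε ≠ 0 := hε.ne'
    have hσne : σ ≠ 0 := hσ.ne'
    have heq : 4 * C₃ * ε * t / (ε / σ) = 4 * C₃ * σ * t := by
      field_simp
    rw [← heq]
    exact h'
  · -- the linear term, kernel entries
    intro σ hσ A' hA' b a δ hδ hδh hsmall i
    have hr : 0 < ε / σ := div_pos hε hσ
    have h := norm_linearTerm_le hU hfd h0 A' (Pi.single b a) (ContinuousLinearMap.proj (R := ℂ) i) hr (hline σ hσ A' hA')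
      (M := 4 * C₃ * ε * Real.exp (δ * 2) * (w 1 b * ‖a‖) * Real.exp (-(δ * distBI D b i)))
      (fun τ hτ => (hpt (τ • A') (hline σ hσ A' hA' τ hτ)).2.2 b a δ hδ hδh hsmall i)
    have h' : ‖(fderiv ℂ (fderiv ℂ Dfun) 0 A') (Pi.single b a) i‖ ≤
        4 * C₃ * ε * Real.exp (δ * 2) * (w 1 b * ‖a‖) * Real.exp (-(δ * distBI D b i)) / (ε / σ) := h
    have hεne : ε ≠ 0 := hε.ne'
    have hσne : σ ≠ 0 := hσ.ne'
    have heq : 4 * C₃ * ε * Real.exp (δ * 2) * (w 1 b * ‖a‖) * Real.exp (-(δ * distBI D b i)) / (ε / σ) =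
        4 * C₃ * σ * Real.exp (δ * 2) * (w 1 b * ‖a‖) * Real.exp (-(δ * distBI D b i)) := by
      field_simp
    rw [← heq]
    exact h'
  · -- the remark, norm level: `M = 4C₃ε·t` on the disc of radius `ε∕σ > 1`
    intro σ hσ hσε A' hA' W t ht hW i
    have hr : 1 < ε / σ := by rwa [lt_div_iff₀ hσ, one_mul]
    have h := norm_fderiv_sub_linearTerm_le hU hfd h0 A' W (ContinuousLinearMap.proj (R := ℂ) i) hr (hline σ hσ A' hA')
      (M := 4 * C₃ * ε * t) (fun τ hτ => (hpt (τ • A') (hline σ hσ A' hA' τ hτ)).2.1 W t ht hW i)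
    have h' : ‖fderiv ℂ Dfun A' W i - (fderiv ℂ (fderiv ℂ Dfun) 0 A') W i‖ ≤ 2 * (4 * C₃ * ε * t) / (ε / σ) ^ 2 := h
    have hsub : (fderiv ℂ Dfun A' - fderiv ℂ (fderiv ℂ Dfun) 0 A') W i = fderiv ℂ Dfun A' W i - (fderiv ℂ (fderiv ℂ Dfun) 0 A') W i := rfl
    have hεne : ε ≠ 0 := hε.ne'
    have hσne : σ ≠ 0 := hσ.ne'
    have heq : 2 * (4 * C₃ * ε * t) / (ε / σ) ^ 2 = 8 * C₃ * (σ ^ 2 / ε) * t := by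
      field_simp
      ring
    rw [hsub, ← heq]
    exact h'
  · -- the remark, kernel entries: `M = 4C₃ε·e^{2δ}·w₁(b)‖a‖·e^{−δ·distBI}` on the same disc
    intro σ hσ hσε A' hA' b a δ hδ hδh hsmall i
    have hr : 1 < ε / σ := by rwa [lt_div_iff₀ hσ, one_mul]
    have h := norm_fderiv_sub_linearTerm_le hU hfd h0 A' (Pi.single b a) (ContinuousLinearMap.proj (R := ℂ) i) hr (hline σ hσ A' hA')
      (M := 4 * C₃ * ε * Real.exp (δ * 2) * (w 1 b * ‖a‖) * Real.exp (-(δ * distBI D b i)))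
      (fun τ hτ => (hpt (τ • A') (hline σ hσ A' hA' τ hτ)).2.2 b a δ hδ hδh hsmall i)
    have h' : ‖fderiv ℂ Dfun A' (Pi.single b a) i - (fderiv ℂ (fderiv ℂ Dfun) 0 A') (Pi.single b a) i‖ ≤
        2 * (4 * C₃ * ε * Real.exp (δ * 2) * (w 1 b * ‖a‖) * Real.exp (-(δ * distBI D b i))) / (ε / σ) ^ 2 := h
    have hsub : (fderiv ℂ Dfun A' - fderiv ℂ (fderiv ℂ Dfun) 0 A') (Pi.single b a) i =
        fderiv ℂ Dfun A' (Pi.single b a) i - (fderiv ℂ (fderiv ℂ Dfun) 0 A') (Pi.single b a) i := rfl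
    have hεne : ε ≠ 0 := hε.ne'
    have hσne : σ ≠ 0 := hσ.ne'
    have heq : 2 * (4 * C₃ * ε * Real.exp (δ * 2) * (w 1 b * ‖a‖) * Real.exp (-(δ * distBI D b i))) / (ε / σ) ^ 2 =
        8 * C₃ * Real.exp (δ * 2) * (σ ^ 2 / ε) * (w 1 b * ‖a‖) * Real.exp (-(δ * distBI D b i)) := by
      field_simp
      ring
    rw [hsub, ← heq]
    exact h'

end Summit.QuantumFields.YangMills.BalabanUVNodes.N07ChartD2Remainder

end
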